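import Literature.NumberTheory.GaloisRepresentations.PseudocharacterTaylorProofs
import Literature.NumberTheory.GaloisRepresentations.FrobeniusDensity
import Literature.NumberTheory.Automorphic.ChebotarevArtinRepHolds
import Literature.NumberTheory.Automorphic.ScholzeTorsionGaloisProofs
import HarnessLib

/-!
# Galois representations as `ℓ`-adic limits (Taylor's pseudo-representation argument)

Topic `Literature/NumberTheory/GaloisRepresentations`; a PROOFS file (theorems only: no
definitions, no named facts — D-0014/D-0026).

## The result

`Literature.NumberTheory.GaloisRepresentations.exists_semisimple_galoisRep_of_ladicLimit`:
let `K` be a number field, `ℓ` a prime, `E ⊆ ℚ̄_ℓ` a finite extension of `ℚ_ℓ`, `S` a finite set of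
finite places of `K` and `P_v ∈ E[X]` (`v ∉ S`) prescribed polynomials.  Suppose that for every
`m ≥ 0` there is a continuous `ρ'_m : Γ_K → GL_n(ℚ̄_ℓ)` which at every `v ∉ S`, `v ∤ ℓ`, is
unramified with Frobenius characteristic polynomial congruent to `P_v` modulo `ℓ^m`
(coefficientwise `‖· - ·‖ ≤ ℓ^{-m}`).  Then there is a continuous SEMISIMPLE
`ρ : Γ_K → GL_n(ℚ̄_ℓ)`, unramified at every `v ∉ S`, `v ∤ ℓ`, with `charpoly ρ(Frob_v) = P_v`.
`galoisRepOfLadicLimit` restates it in the closed `∀`-form of the support item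
`GaloisRepOfLadicLimit` (stmt-Langlands-2632) of route `Langlands/DegenerateLimits`.

This is the "`𝔭`-adic system of pseudo-representations ⇒ Galois representation" step by which
Galois representations are attached to automorphic forms of non-cohomological weight from
congruences to cohomological ones: Taylor 1991 (holomorphic Siegel forms of low weight, §1 and
the proof of Thm. 2), after Wiles and Deligne–Serre; used verbatim in Goldring–Koskivirta 2019,
§11.1 (proof of Thm. 3.5.1/3.5.5, Case [LDS]: "The compositions `θ_n ∘ R` form a `𝔭`-adic
system of pseudo-representations. Hence their limit gives a `ℚ̄_p`-valued pseudo-representation.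
By [Taylor 1991], this `ℚ̄_p`-valued pseudo-representation is the trace of a unique true,
semisimple representation satisfying the desiderata …"), in Jarvis 1997, Goldring 2014 and
Harris–Lan–Taylor–Thorne 2016.

## Proof (as formalised; the printed argument with its folklore details supplied)

1. *Uniform Cauchy from congruences on Frobenii.*  For each `k` the coefficient functions
   `c^m_k : g ↦ coeff_k charpoly(ρ'_m g)` are continuous.  Two of them (`m ≤ m'`) are within
   `ℓ^{-m}` of each other on every arithmetic Frobenius at places outside
   `S' = S ∪ {v ∣ ℓ}` (both are within `ℓ^{-m}` of `coeff_k P_v`, ultrametric inequality), and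
   these Frobenii are dense in `Γ_K` (Chebotarev, tree theorem `absoluteGaloisGroup.frobenius_dense`
   fed with `chebotarev_artinRep_holds`); a closed condition, so it holds on all of `Γ_K`.  The
   same density argument puts every `c^m_k(g)` within `ℓ^{-m}` of the complete field `E`.  Hence
   `c^m_k → T_k` uniformly, `T_k : Γ_K → E` continuous (`exists_continuous_limit_of_dense`).
2. *The limit pseudocharacter.*  `χ(g) := X^n + ∑_{k<n} T_k(g) X^k` is the coefficientwise limit
   of `charpoly(ρ'_m g)`; power sums of roots are integer polynomials in the coefficients
   (fundamental theorem of symmetric polynomials, Mathlib `MvPolynomial.esymmAlgHom_surjective`),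
   so `tr ρ'_m(g) = p_1(roots) → T(g) := p_1(roots χ(g))` pointwise; a pointwise limit of the
   pseudocharacters `tr ρ'_m` (`Rouquier1996_prop_3_1_trace_holds`) is a pseudocharacter
   (`IsPseudocharacter.of_tendsto`), continuous and `E`-valued.
3. *Taylor's theorem* in the continuous `ℓ`-adic form of Bellaïche–Chenevier
   (`BellaicheChenevier2009_continuous_rep_of_pseudocharacter_holds`): `T = tr ρ` for a continuous
   semisimple `ρ : Γ_K → GL_n(ℚ̄_ℓ)`.
4. *Characteristic polynomials of `ρ`.*  For every `g`, `tr ρ(g^j) = T(g^j) = lim tr ρ'_m(g^j)`;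
   traces of powers are power sums of the roots of the characteristic polynomial
   (generalised-eigenspace decomposition, `LadicLimit.matrix_trace_pow_eq_sum_roots_pow`), and in
   characteristic `0` the first `n` power sums determine a multiset of `n` roots (Newton's
   identities, Mathlib `MvPolynomial.mul_esymm_eq_sum`; `LadicLimit.multiset_eq_of_psum_eq`).
   Hence `charpoly ρ(g) = χ(g)` for ALL `g ∈ Γ_K`.
5. *Unramifiedness and Frobenius.*  For `τ` in an inertia group at `v ∉ S'` each `ρ'_m` has
   `ρ'_m(gτ) = ρ'_m(g)`, so `χ(gτ) = χ(g)` and `charpoly ρ(gτ) = charpoly ρ(g)` for all `g`; the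
   kernel of a semisimple representation is cut out by characteristic polynomials (Clifford +
   Brauer–Nesbitt, tree theorem `Automorphic.apply_eq_one_of_mem_charpolyKer`, Chenevier 2014
   Thm. A), so `ρ(τ) = 1`.  At an arithmetic Frobenius `σ` at `v`, `χ(σ) = lim charpoly ρ'_m(σ) = P_v`.

## References

* R. Taylor, *Galois representations associated to Siegel modular forms of low weight*, Duke
  Math. J. 63 (1991) 281–332, §1 (pseudo-representations, Theorem 1) and the proof of Theorem 2.
  [cite: Taylor1991, §1 Theorem 1]
* W. Goldring, J.-S. Koskivirta, *Strata Hasse invariants, Hecke algebras and Galois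
  representations*, Invent. Math. 217 (2019), §11.1 (arXiv:1507.05032 p. 40).
  [cite: GoldringKoskivirta2019, §11.1]
* J. Bellaïche, G. Chenevier, *Families of Galois representations and Selmer groups*,
  Astérisque 324 (2009), §4.2.2. [cite: BellaicheChenevier2009, §4.2.2]
* P. Deligne, J.-P. Serre, *Formes modulaires de poids 1*, Ann. Sci. ÉNS 7 (1974), §8.
-/

noncomputable section

open scoped NumberField
open Filter Topology Polynomial Field IsDedekindDomain

namespace Literature.NumberTheory.GaloisRepresentations

namespace LadicLimit

/-! ### Linear algebra: traces of powers are power sums of the characteristic roots -/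

section TracePow

open Module Module.End

variable {F V : Type*} [Field F] [AddCommGroup V] [Module F V]

/-- `tr(f ^ m) = Σ_μ mult_μ(χ_f) · μ ^ m` for an endomorphism of a finite-dimensional vector space
over an algebraically closed field: `V = ⊕_μ V(μ)` (generalised eigenspaces, Mathlib
`Module.End.iSup_maxGenEigenspace_eq_top`), `f ^ m - μ ^ m` is nilpotent on `V(μ)`, and
`dim V(μ) = mult_μ(χ_f)` (Mathlib `LinearMap.finrank_maxGenEigenspace_eq`).
Ref: Bourbaki, *Algèbre*, Ch. VII §5 no. 5. [folklore] -/
theorem trace_pow_eq_sum_rootMultiplicity [IsAlgClosed F] [FiniteDimensional F V] [DecidableEq F]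
    (f : End F V) (m : ℕ) :
    LinearMap.trace F V (f ^ m) =
      ∑ μ ∈ f.charpoly.roots.toFinset, (f.charpoly.rootMultiplicity μ : F) * μ ^ m := by
  have hint : DirectSum.IsInternal f.maxGenEigenspace :=
    DirectSum.isInternal_submodule_of_iSupIndep_of_iSup_eq_top f.independent_maxGenEigenspace
      f.iSup_maxGenEigenspace_eq_top
  have hne : f.charpoly ≠ 0 := f.charpoly_monic.ne_zero
  have hsupp : {μ : F | f.maxGenEigenspace μ ≠ ⊥} = (f.charpoly.roots.toFinset : Set F) := by
    ext μ
    simp only [Set.mem_setOf_eq, Finset.mem_coe, Multiset.mem_toFinset, mem_roots hne, ne_eq]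
    rw [← rootMultiplicity_pos hne, ← LinearMap.finrank_maxGenEigenspace_eq, pos_iff_ne_zero, ne_eq,
      not_iff_not, Submodule.finrank_eq_zero]
  have hfin : {μ : F | f.maxGenEigenspace μ ≠ ⊥}.Finite := by
    rw [hsupp]; exact Finset.finite_toSet _
  have hmaps : ∀ μ : F, Set.MapsTo ⇑(f ^ m) ↑(f.maxGenEigenspace μ) ↑(f.maxGenEigenspace μ) :=
    fun μ => mapsTo_maxGenEigenspace_of_comm (Commute.pow_right (Commute.refl f) m) μ
  rw [LinearMap.trace_eq_sum_trace_restrict' hint hfin hmaps]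
  have hset : hfin.toFinset = f.charpoly.roots.toFinset := by
    rw [← Finset.coe_inj, Set.Finite.coe_toFinset, hsupp]
  rw [hset]
  refine Finset.sum_congr rfl fun μ _ ↦ ?_
  set W := f.maxGenEigenspace μ
  have hW : Set.MapsTo ⇑(f - algebraMap F (End F V) μ) ↑W ↑W :=
    mapsTo_maxGenEigenspace_of_comm (Algebra.mul_sub_algebraMap_commutes f μ) μ
  have hnil : IsNilpotent ((f - algebraMap F (End F V) μ).restrict hW) :=
    isNilpotent_restrict_maxGenEigenspace_sub_algebraMap f μ hW
  obtain ⟨q, hq⟩ : ∃ q : F[X], (X : F[X]) ^ m - C (μ ^ m) = (X - C μ) * q := by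
    have h : (X - C μ) ∣ (X : F[X]) ^ m - C (μ ^ m) := by
      rw [dvd_iff_isRoot]; simp
    exact h
  have hfW : Set.MapsTo ⇑f ↑W ↑W := mapsTo_maxGenEigenspace_of_comm (Commute.refl f) μ
  have e2 : (f - algebraMap F (End F V) μ).restrict hW = aeval (f.restrict hfW) (X - C μ) := by
    rw [map_sub, aeval_X, aeval_C]
    ext ⟨v, hv⟩
    simp [LinearMap.restrict_apply, Module.algebraMap_end_apply]
  have key : (f ^ m).restrict (hmaps μ) - algebraMap F (Module.End F ↥W) (μ ^ m) =
      (f - algebraMap F (End F V) μ).restrict hW * aeval (f.restrict hfW) q := by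
    have e1 : (f ^ m).restrict (hmaps μ) = aeval (f.restrict hfW) ((X : F[X]) ^ m) := by
      rw [map_pow, aeval_X, Module.End.pow_restrict]
    rw [e1, e2, ← map_mul, ← hq, map_sub, aeval_C]
  have hcomm : Commute ((f - algebraMap F (End F V) μ).restrict hW) (aeval (f.restrict hfW) q) := by
    rw [e2]
    exact (Commute.all (X - C μ) q).map (aeval (f.restrict hfW))
  have hnil2 : IsNilpotent ((f ^ m).restrict (hmaps μ) - algebraMap F (Module.End F ↥W) (μ ^ m)) := by
    rw [key]; exact hcomm.isNilpotent_mul_right hnil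
  have htr0 : LinearMap.trace F ↥W
      ((f ^ m).restrict (hmaps μ) - algebraMap F (Module.End F ↥W) (μ ^ m)) = 0 :=
    (LinearMap.isNilpotent_trace_of_isNilpotent hnil2).eq_zero
  rw [map_sub, sub_eq_zero] at htr0
  rw [htr0, Module.algebraMap_end_eq_smul_id, map_smul, LinearMap.trace_id, smul_eq_mul, mul_comm,
    LinearMap.finrank_maxGenEigenspace_eq]

/-- **Matrix form**: `tr(A ^ m) = Σ_{μ root of χ_A, with multiplicity} μ ^ m` for a square
matrix over an algebraically closed field.
Ref: Bourbaki, *Algèbre*, Ch. VII §5 no. 5. [folklore] -/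
theorem matrix_trace_pow_eq_sum_roots_pow [IsAlgClosed F] {ι : Type*} [Fintype ι] [DecidableEq ι]
    (A : Matrix ι ι F) (m : ℕ) :
    (A ^ m).trace = (A.charpoly.roots.map (· ^ m)).sum := by
  classical
  have h1 := trace_pow_eq_sum_rootMultiplicity (Matrix.toLin' A) m
  rw [← Matrix.toLin'_pow, Matrix.trace_toLin'_eq, Matrix.charpoly_toLin'] at h1
  rw [h1, Finset.sum_multiset_map_count]
  refine Finset.sum_congr rfl fun μ _ => ?_
  rw [count_roots, nsmul_eq_mul]

end TracePow

/-! ### Newton: power sums versus elementary symmetric functions -/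

section Newton

/-- Evaluating the power sum `psum` at the enumeration of a list. [folklore] -/
theorem aeval_get_psum {S : Type*} [CommRing S] (l : List S) (j : ℕ) :
    MvPolynomial.aeval l.get (MvPolynomial.psum (Fin l.length) ℤ j) =
      ((l : Multiset S).map (· ^ j)).sum := by
  have hxs : (Finset.univ.val.map l.get : Multiset S) = (l : Multiset S) := by
    rw [Fin.univ_val_map, List.ofFn_get]
  simp only [MvPolynomial.psum, map_sum, map_pow, MvPolynomial.aeval_X]
  rw [← hxs, Multiset.map_map, Finset.sum_eq_multiset_sum]
  rfl

/-- Evaluating the elementary symmetric polynomial `esymm` at the enumeration of a list. [folklore] -/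
theorem aeval_get_esymm {S : Type*} [CommRing S] (l : List S) (k : ℕ) :
    MvPolynomial.aeval l.get (MvPolynomial.esymm (Fin l.length) ℤ k) = (l : Multiset S).esymm k := by
  rw [MvPolynomial.aeval_esymm_eq_multiset_esymm, Fin.univ_val_map, List.ofFn_get]

/-- **Power sums are integer polynomials in the elementary symmetric functions**: for every
`n, j` there is `Ψ ∈ ℤ[Y_0, …, Y_{n-1}]` with `∑_{a ∈ s} a ^ j = Ψ(e_1(s), …, e_n(s))` for every
multiset `s` with `n` elements (fundamental theorem of symmetric polynomials, Mathlib
`MvPolynomial.esymmAlgHom_surjective`, applied to `MvPolynomial.psum`).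
Ref: Bourbaki, *Algèbre*, Ch. IV §6 no. 1, Thm. 1. [folklore] -/
theorem exists_mvPolynomial_psum_eq_aeval_esymm (S : Type*) [CommRing S] (n j : ℕ) :
    ∃ Ψ : MvPolynomial (Fin n) ℤ, ∀ s : Multiset S, Multiset.card s = n →
      (s.map (· ^ j)).sum = MvPolynomial.aeval (fun i : Fin n => s.esymm ((i : ℕ) + 1)) Ψ := by
  obtain ⟨Ψ, hΨ⟩ := MvPolynomial.esymmAlgHom_surjective (σ := Fin n) (R := ℤ) (n := n) (by simp)
    ⟨MvPolynomial.psum (Fin n) ℤ j, MvPolynomial.psum_isSymmetric _ _ j⟩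
  refine ⟨Ψ, fun s hs => ?_⟩
  have hΨ' : MvPolynomial.aeval (fun i : Fin n => MvPolynomial.esymm (Fin n) ℤ ((i : ℕ) + 1)) Ψ =
      MvPolynomial.psum (Fin n) ℤ j := by
    rw [← MvPolynomial.esymmAlgHom_apply, hΨ]
  obtain ⟨l, rfl⟩ : ∃ l : List S, (l : Multiset S) = s := ⟨s.toList, s.coe_toList⟩
  rw [Multiset.coe_card] at hs
  subst hs
  have hcomp : (MvPolynomial.aeval l.get).comp
      (MvPolynomial.aeval (fun i : Fin l.length => MvPolynomial.esymm (Fin l.length) ℤ ((i : ℕ) + 1))) =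
      MvPolynomial.aeval (fun i : Fin l.length =>
        MvPolynomial.aeval l.get (MvPolynomial.esymm (Fin l.length) ℤ ((i : ℕ) + 1))) := by
    ext i
    simp
  have h := congrArg (MvPolynomial.aeval l.get) hΨ'
  rw [← AlgHom.comp_apply, hcomp, aeval_get_psum] at h
  simp only [aeval_get_esymm] at h
  exact h.symm

open Finset in
/-- **Newton's identity** for a multiset: `k e_k(s) = (-1)^(k+1) ∑_{i<k} (-1)^i e_i(s) p_{k-i}(s)`
(Mathlib `MvPolynomial.mul_esymm_eq_sum` evaluated at an enumeration of `s`).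
Ref: Bourbaki, *Algèbre*, Ch. IV §6 no. 5. [folklore] -/
theorem multiset_mul_esymm_eq_sum {S : Type*} [CommRing S] (s : Multiset S) (k : ℕ) :
    (k : S) * s.esymm k = (-1) ^ (k + 1) *
      ∑ a ∈ antidiagonal k with a.1 < k, (-1) ^ a.1 * s.esymm a.1 * (s.map (· ^ a.2)).sum := by
  obtain ⟨l, rfl⟩ : ∃ l : List S, (l : Multiset S) = s := ⟨s.toList, s.coe_toList⟩
  have h := congrArg (MvPolynomial.aeval l.get) (MvPolynomial.mul_esymm_eq_sum (Fin l.length) ℤ k)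
  simp only [map_mul, map_natCast, map_sum, map_pow, map_neg, map_one, aeval_get_esymm,
    aeval_get_psum] at h
  exact h

open Finset in
/-- **In characteristic zero a multiset of `n` elements is determined by its first `n` power
sums** (Newton's identities recursively determine `e_1, …, e_n`, then Vieta).
Ref: Bourbaki, *Algèbre*, Ch. IV §6 no. 5, Cor. [folklore] -/
theorem multiset_eq_of_psum_eq {S : Type*} [Field S] [CharZero S] {s t : Multiset S} {n : ℕ}
    (hs : Multiset.card s = n) (ht : Multiset.card t = n)
    (h : ∀ j, 1 ≤ j → j ≤ n → (s.map (· ^ j)).sum = (t.map (· ^ j)).sum) : s = t := by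
  have hes : ∀ k, k ≤ n → s.esymm k = t.esymm k := by
    intro k
    induction k using Nat.strong_induction_on with
    | _ k ih =>
      intro hk
      rcases Nat.eq_zero_or_pos k with rfl | hkpos
      · simp [Multiset.esymm]
      have h1 := multiset_mul_esymm_eq_sum s k
      have h2 := multiset_mul_esymm_eq_sum t k
      have hsum : ∑ a ∈ antidiagonal k with a.1 < k,
            (-1) ^ a.1 * s.esymm a.1 * (s.map (· ^ a.2)).sum =
          ∑ a ∈ antidiagonal k with a.1 < k,
            (-1) ^ a.1 * t.esymm a.1 * (t.map (· ^ a.2)).sum := by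
        refine Finset.sum_congr rfl fun a ha => ?_
        rw [Finset.mem_filter, Finset.HasAntidiagonal.mem_antidiagonal] at ha
        rw [ih a.1 ha.2 (by omega), h a.2 (by omega) (by omega)]
      have hk0 : (k : S) ≠ 0 := Nat.cast_ne_zero.mpr hkpos.ne'
      apply mul_left_cancel₀ hk0
      rw [h1, h2, hsum]
  have hprod : (s.map fun a => X - C a).prod = (t.map fun a => X - C a).prod := by
    ext k
    by_cases hk : k ≤ n
    · rw [Multiset.prod_X_sub_C_coeff s (hs ▸ hk), Multiset.prod_X_sub_C_coeff t (ht ▸ hk), hs, ht,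
        hes _ (Nat.sub_le n k)]
    · rw [not_le] at hk
      have hds : (s.map fun a => X - C a).prod.natDegree < k := by
        rw [Polynomial.natDegree_multiset_prod_X_sub_C_eq_card, hs]; exact hk
      have hdt : (t.map fun a => X - C a).prod.natDegree < k := by
        rw [Polynomial.natDegree_multiset_prod_X_sub_C_eq_card, ht]; exact hk
      rw [coeff_eq_zero_of_natDegree_lt hds, coeff_eq_zero_of_natDegree_lt hdt]
  have h1 := Polynomial.roots_multiset_prod_X_sub_C s
  have h2 := Polynomial.roots_multiset_prod_X_sub_C t
  rw [← h1, ← h2, hprod]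

end Newton

/-! ### Uniform limits from congruences on a dense set -/

section Limits

variable {ℓ : ℕ} [Fact ℓ.Prime]

/-- `ℓ^{-m} > 0`. [folklore] -/
theorem zpow_neg_natCast_pos (m : ℕ) : 0 < (ℓ : ℝ) ^ (-(m : ℤ)) :=
  zpow_pos (by exact_mod_cast (Fact.out : ℓ.Prime).pos) _

/-- `m ↦ ℓ^{-m}` is antitone. [folklore] -/
theorem zpow_neg_natCast_antitone {m m' : ℕ} (h : m ≤ m') :
    (ℓ : ℝ) ^ (-(m' : ℤ)) ≤ (ℓ : ℝ) ^ (-(m : ℤ)) :=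
  zpow_le_zpow_right₀ (by exact_mod_cast (Fact.out : ℓ.Prime).one_lt.le)
    (neg_le_neg (by exact_mod_cast h))

/-- `ℓ^{-m} → 0`. [folklore] -/
theorem tendsto_zpow_neg_natCast : Tendsto (fun m : ℕ => (ℓ : ℝ) ^ (-(m : ℤ))) atTop (𝓝 0) := by
  have h : (fun m : ℕ => (ℓ : ℝ) ^ (-(m : ℤ))) = fun m : ℕ => ((ℓ : ℝ)⁻¹) ^ m := by
    funext m; rw [zpow_neg, zpow_natCast, inv_pow]
  rw [h]
  exact tendsto_pow_atTop_nhds_zero_of_lt_one (inv_nonneg.mpr (Nat.cast_nonneg ℓ))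
    (inv_lt_one_of_one_lt₀ (by exact_mod_cast (Fact.out : ℓ.Prime).one_lt))

/-- `2 ℓ^{-(m+1)} ≤ ℓ^{-m}` (as `ℓ ≥ 2`). [folklore] -/
theorem two_mul_zpow_neg_succ_le (m : ℕ) :
    2 * (ℓ : ℝ) ^ (-((m + 1 : ℕ) : ℤ)) ≤ (ℓ : ℝ) ^ (-(m : ℤ)) := by
  have hℓ : (2 : ℝ) ≤ ℓ := by exact_mod_cast (Fact.out : ℓ.Prime).two_le
  have hℓ0 : (0 : ℝ) < ℓ := by linarith
  have e : (ℓ : ℝ) ^ (-((m + 1 : ℕ) : ℤ)) = (ℓ : ℝ) ^ (-(m : ℤ)) * (ℓ : ℝ)⁻¹ := by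
    rw [Nat.cast_succ, neg_add, zpow_add₀ hℓ0.ne', zpow_neg_one]
  rw [e]
  have hp := zpow_neg_natCast_pos (ℓ := ℓ) m
  calc 2 * ((ℓ : ℝ) ^ (-(m : ℤ)) * (ℓ : ℝ)⁻¹) = (ℓ : ℝ) ^ (-(m : ℤ)) * (2 / ℓ) := by ring
    _ ≤ (ℓ : ℝ) ^ (-(m : ℤ)) * 1 := by
        refine mul_le_mul_of_nonneg_left ?_ hp.le
        rw [div_le_one hℓ0]; exact hℓ
    _ = _ := mul_one _

/-- **Interpolation of functions from congruences on a dense set.**  Let `X` be a topological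
space with a dense subset `D`, `E ⊆ ℚ̄_ℓ` a finite extension of `ℚ_ℓ`, `f_m : X → ℚ̄_ℓ`
continuous functions and `t : X → ℚ̄_ℓ` a target which is `E`-valued on `D`, such that
`‖f_m(d) - t(d)‖ ≤ ℓ^{-m}` for all `m` and all `d ∈ D`.  Then the `f_m` converge uniformly to a
continuous `E`-valued `F` with `‖f_m - F‖ ≤ ℓ^{-m}` everywhere and `F = t` on `D`.
(Ultrametric inequality: `‖f_m - f_{m'}‖ ≤ ℓ^{-m}` and `dist(f_m, E) ≤ ℓ^{-m}` are closed
conditions holding on `D`; completeness of `E`.)  The analytic half of the "`𝔭`-adic systems of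
pseudo-representations" step of Taylor 1991 / Goldring–Koskivirta 2019 §11.1. [folklore] -/
theorem exists_continuous_limit_of_dense {X : Type*} [TopologicalSpace X] {D : Set X} (hD : Dense D)
    (E : IntermediateField ℚ_[ℓ] (PadicAlgCl ℓ)) [FiniteDimensional ℚ_[ℓ] E]
    (f : ℕ → X → PadicAlgCl ℓ) (hf : ∀ m, Continuous (f m)) (t : X → PadicAlgCl ℓ)
    (htE : ∀ d ∈ D, t d ∈ E)
    (happ : ∀ m, ∀ d ∈ D, ‖f m d - t d‖ ≤ (ℓ : ℝ) ^ (-(m : ℤ))) :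
    ∃ F : X → PadicAlgCl ℓ, Continuous F ∧ (∀ x, F x ∈ E) ∧
      (∀ m x, ‖f m x - F x‖ ≤ (ℓ : ℝ) ^ (-(m : ℤ))) ∧ ∀ d ∈ D, F d = t d := by
  set r : ℕ → ℝ := fun m => (ℓ : ℝ) ^ (-(m : ℤ)) with hr
  have hr_pos : ∀ m, 0 < r m := fun m => zpow_neg_natCast_pos m
  have hr_anti : ∀ {m m' : ℕ}, m ≤ m' → r m' ≤ r m := fun h => zpow_neg_natCast_antitone h
  have hr_lim : Tendsto r atTop (𝓝 0) := tendsto_zpow_neg_natCast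
  have hall : ∀ {p : X → Prop}, IsClosed {x | p x} → (∀ d ∈ D, p d) → ∀ x, p x := by
    intro p hA hDA x
    have : closure D ⊆ {x | p x} := closure_minimal (fun d hd => hDA d hd) hA
    rw [hD.closure_eq] at this
    exact this (Set.mem_univ x)
  have nsub : ∀ a b : PadicAlgCl ℓ, ‖a - b‖ ≤ max ‖a‖ ‖b‖ := fun a b => by
    simpa [sub_eq_add_neg, norm_neg] using IsUltrametricDist.norm_add_le_max a (-b)
  -- (a) uniform closeness of the `f_m` everywhere
  have hclose : ∀ {m m' : ℕ}, m ≤ m' → ∀ x, ‖f m x - f m' x‖ ≤ r m := by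
    intro m m' hmm'
    refine hall (p := fun x => ‖f m x - f m' x‖ ≤ r m)
      (isClosed_le ((hf m).sub (hf m')).norm continuous_const) fun d hd => ?_
    have e : f m d - f m' d = (f m d - t d) - (f m' d - t d) := by ring
    rw [e]
    exact (nsub _ _).trans (max_le (happ m d hd) ((happ m' d hd).trans (hr_anti hmm')))
  -- (b) every `f_m x` is within `r m` of `E`
  have hnear : ∀ m x, Metric.infDist (f m x) (E : Set (PadicAlgCl ℓ)) ≤ r m := by
    intro m
    refine hall (p := fun x => Metric.infDist (f m x) (E : Set (PadicAlgCl ℓ)) ≤ r m)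
      (isClosed_le ((Metric.continuous_infDist_pt _).comp (hf m)) continuous_const)
      fun d hd => ?_
    refine (Metric.infDist_le_dist_of_mem (htE d hd)).trans ?_
    rw [dist_eq_norm]; exact happ m d hd
  have hex : ∀ m x, ∃ e : PadicAlgCl ℓ, e ∈ E ∧ ‖f m x - e‖ < 2 * r m := by
    intro m x
    have hne : (E : Set (PadicAlgCl ℓ)).Nonempty := ⟨0, E.zero_mem⟩
    have hlt : Metric.infDist (f m x) (E : Set (PadicAlgCl ℓ)) < 2 * r m :=
      (hnear m x).trans_lt (by linarith [hr_pos m])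
    obtain ⟨e, he, hde⟩ := (Metric.infDist_lt_iff hne).mp hlt
    exact ⟨e, he, by rwa [dist_eq_norm] at hde⟩
  choose e heE hfe using hex
  have he_close : ∀ {m m' : ℕ}, m ≤ m' → ∀ x, ‖e m x - e m' x‖ < 2 * r m := by
    intro m m' hmm' x
    have e1 : e m x - e m' x = (f m' x - e m' x) - (f m x - e m x) - (f m' x - f m x) := by ring
    rw [e1]
    refine (nsub _ _).trans_lt (max_lt ?_ ?_)
    · refine (nsub _ _).trans_lt (max_lt ?_ (hfe m x))
      exact (hfe m' x).trans_le (by linarith [hr_anti hmm'])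
    · rw [norm_sub_rev]; exact (hclose hmm' x).trans_lt (by linarith [hr_pos m])
  -- the `E`-valued sequences `m ↦ e m x` are Cauchy, hence converge in the complete `E`
  haveI : CompleteSpace E := FiniteDimensional.complete ℚ_[ℓ] E
  have hconv : ∀ x, ∃ F0 : E, Tendsto (fun m => (⟨e m x, heE m x⟩ : E)) atTop (𝓝 F0) := by
    intro x
    apply cauchySeq_tendsto_of_complete
    refine Metric.cauchySeq_iff'.2 fun ε hε => ?_
    obtain ⟨N, hN⟩ := ((tendsto_order.1 hr_lim).2 (ε / 2) (by linarith)).exists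
    refine ⟨N, fun m hm => ?_⟩
    rw [dist_eq_norm, ← norm_neg, neg_sub]
    change ‖e N x - e m x‖ < ε
    exact (he_close hm x).trans_le (by linarith)
  choose F0 hF0 using hconv
  have hF : ∀ x, Tendsto (fun m => e m x) atTop (𝓝 (F0 x : PadicAlgCl ℓ)) := fun x =>
    ((continuous_subtype_val).tendsto _).comp (hF0 x)
  have hbound : ∀ m x, ‖f m x - (F0 x : PadicAlgCl ℓ)‖ ≤ r m := by
    intro m x
    have hlim : Tendsto (fun m' => ‖f m x - e m' x‖) atTop (𝓝 ‖f m x - (F0 x : PadicAlgCl ℓ)‖) :=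
      ((continuous_norm.comp (continuous_const.sub continuous_id)).tendsto _).comp (hF x)
    refine le_of_tendsto hlim (eventually_atTop.2 ⟨m + 1, fun m' hm' => ?_⟩)
    have e1 : f m x - e m' x = (f m x - f m' x) + (f m' x - e m' x) := by ring
    rw [e1]
    refine (IsUltrametricDist.norm_add_le_max _ _).trans (max_le (hclose (by omega) x) ?_)
    refine (hfe m' x).le.trans ?_
    calc 2 * r m' ≤ 2 * r (m + 1) := by linarith [hr_anti hm']
      _ ≤ r m := two_mul_zpow_neg_succ_le m
  refine ⟨fun x => (F0 x : PadicAlgCl ℓ), ?_, fun x => (F0 x).2, hbound, ?_⟩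
  · have hU : TendstoUniformly f (fun x => (F0 x : PadicAlgCl ℓ)) atTop := by
      refine Metric.tendstoUniformly_iff.2 fun ε hε => ?_
      obtain ⟨N, hN⟩ := ((tendsto_order.1 hr_lim).2 ε hε).exists_forall_of_atTop
      refine eventually_atTop.2 ⟨N, fun m hm x => ?_⟩
      rw [dist_comm, dist_eq_norm]
      exact (hbound m x).trans_lt (hN m hm)
    exact hU.continuous (Eventually.of_forall hf).frequently
  · intro d hd
    rw [← sub_eq_zero, ← norm_le_zero_iff]
    refine ge_of_tendsto' hr_lim fun m => ?_
    have e1 : (F0 d : PadicAlgCl ℓ) - t d = (f m d - t d) - (f m d - (F0 d : PadicAlgCl ℓ)) := by ring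
    rw [e1]
    exact (nsub _ _).trans (max_le (happ m d hd) (hbound m d))

end Limits

end LadicLimit

/-! ### The interpolation theorem -/

section Main

open LadicLimit

variable {ℓ : ℕ} [Fact ℓ.Prime]

/-- The coefficients of `g ↦ charpoly ρ(g)` are continuous (integer polynomials in the matrix
entries, Mathlib `Matrix.charpoly.univ`). [folklore] -/
theorem LadicLimit.continuous_coeff_charpoly {G : Type*} [Group G] [TopologicalSpace G]
    {A : Type*} [CommRing A] [TopologicalSpace A] [IsTopologicalRing A] {n : ℕ}
    (ρ : FramedRep G A n) (k : ℕ) :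
    Continuous fun g => (FramedRep.charpoly ρ g).coeff k := by
  have h : ∀ M : Matrix (Fin n) (Fin n) A, M.charpoly.coeff k =
      MvPolynomial.eval (fun ij : Fin n × Fin n => M ij.1 ij.2)
        (MvPolynomial.map (Int.castRingHom A) ((Matrix.charpoly.univ ℤ (Fin n)).coeff k)) := by
    intro M
    rw [MvPolynomial.eval_map, ← MvPolynomial.coe_eval₂Hom, Matrix.charpoly.univ_coeff_eval₂Hom]
    rfl
  have hM : Continuous fun g : G => ((ρ g : GL (Fin n) A) : Matrix (Fin n) (Fin n) A) :=
    Units.continuous_val.comp (map_continuous ρ)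
  simp_rw [FramedRep.charpoly, h]
  exact (MvPolynomial.continuous_eval _).comp
    (continuous_pi fun ij => (continuous_id.matrix_elem ij.1 ij.2).comp hM)

/-- Unfolding `FramedRep.charpoly`. [folklore] -/
theorem LadicLimit.charpoly_def {G : Type*} [Group G] [TopologicalSpace G]
    {A : Type*} [CommRing A] [TopologicalSpace A] {n : ℕ} (ρ : FramedRep G A n) (g : G) :
    FramedRep.charpoly ρ g = ((ρ g : GL (Fin n) A) : Matrix (Fin n) (Fin n) A).charpoly := rfl

/-- `charpoly ρ(g)` is monic of degree `n`. [folklore] -/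
theorem LadicLimit.natDegree_charpoly {G : Type*} [Group G] [TopologicalSpace G]
    {A : Type*} [CommRing A] [TopologicalSpace A] [Nontrivial A] {n : ℕ} (ρ : FramedRep G A n)
    (g : G) : (FramedRep.charpoly ρ g).natDegree = n := by
  rw [LadicLimit.charpoly_def, Matrix.charpoly_natDegree_eq_dim, Fintype.card_fin]

/-- Over an algebraically closed field `charpoly ρ(g)` has `n` roots with multiplicity. [folklore] -/
theorem LadicLimit.card_roots_charpoly {G : Type*} [Group G] [TopologicalSpace G]
    {A : Type*} [Field A] [IsAlgClosed A] [TopologicalSpace A] {n : ℕ} (ρ : FramedRep G A n)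
    (g : G) : Multiset.card (FramedRep.charpoly ρ g).roots = n := by
  rw [splits_iff_card_roots.1 (IsAlgClosed.splits _), LadicLimit.natDegree_charpoly]

/-- **Galois representations as `ℓ`-adic limits** (Taylor 1991, §1 and proof of Thm. 2;
Goldring–Koskivirta 2019, §11.1; Deligne–Serre 1974, §8).  Let `K` be a number field, `ℓ` a
prime, `E ⊆ ℚ̄_ℓ` finite over `ℚ_ℓ`, `S` a finite set of finite places of `K`, and
`P_v ∈ E[X]` for `v ∉ S`.  If for every `m` there is a continuous `ρ'_m : Γ_K → GL_n(ℚ̄_ℓ)` which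
is unramified at every `v ∉ S`, `v ∤ ℓ`, with Frobenius characteristic polynomial within `ℓ^{-m}`
of `P_v` coefficientwise, then there is a continuous **semisimple** `ρ : Γ_K → GL_n(ℚ̄_ℓ)`,
unramified at every `v ∉ S`, `v ∤ ℓ`, with `charpoly ρ(Frob_v) = P_v` (arithmetic Frobenius, the
tree's `HasFrobCharpolyAt`).  Proof: module docstring (density of Frobenii ⇒ uniform limits of
the coefficient functions; the limit of the traces is a continuous `E`-valued pseudocharacter;
Taylor's theorem in Bellaïche–Chenevier's continuous form; characteristic polynomials of `ρ` from
traces of powers and Newton's identities; unramifiedness by Clifford–Brauer–Nesbitt).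
[cite: Taylor1991, §1 Theorem 1] [cite: GoldringKoskivirta2019, §11.1] -/
theorem exists_semisimple_galoisRep_of_ladicLimit (K : Type) [Field K] [NumberField K] (n : ℕ)
    (E : IntermediateField ℚ_[ℓ] (PadicAlgCl ℓ)) [FiniteDimensional ℚ_[ℓ] E]
    (S : Set (HeightOneSpectrum (𝓞 K))) (hS : S.Finite)
    (P : HeightOneSpectrum (𝓞 K) → (PadicAlgCl ℓ)[X])
    (hP : ∀ v ∉ S, ∀ k : ℕ, (P v).coeff k ∈ E)
    (happrox : ∀ m : ℕ, ∃ ρ' : FramedGaloisRep K (PadicAlgCl ℓ) n, ∀ v ∉ S,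
      ((ℓ : ℕ) : 𝓞 K) ∉ v.asIdeal → ρ'.IsUnramifiedAt v ∧ ∃ Q : (PadicAlgCl ℓ)[X],
        ρ'.HasFrobCharpolyAt v Q ∧ ∀ k : ℕ, ‖Q.coeff k - (P v).coeff k‖ ≤ (ℓ : ℝ) ^ (-(m : ℤ))) :
    ∃ ρ : FramedGaloisRep K (PadicAlgCl ℓ) n, ρ.toGaloisRep.IsSemisimple ∧
      ∀ v ∉ S, ((ℓ : ℕ) : 𝓞 K) ∉ v.asIdeal → ρ.IsUnramifiedAt v ∧ ρ.HasFrobCharpolyAt v (P v) := by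
  classical
  set r : ℕ → ℝ := fun m => (ℓ : ℝ) ^ (-(m : ℤ)) with hr
  have hr_lim : Tendsto r atTop (𝓝 0) := tendsto_zpow_neg_natCast
  have nsub : ∀ a b : PadicAlgCl ℓ, ‖a - b‖ ≤ max ‖a‖ ‖b‖ := fun a b => by
    simpa [sub_eq_add_neg, norm_neg] using IsUltrametricDist.norm_add_le_max a (-b)
  choose ρ' hρ' using happrox
  -- the finite exceptional set `S' = S ∪ {v ∣ ℓ}` and the dense set of Frobenii
  have hSℓ : {v : HeightOneSpectrum (𝓞 K) | ((ℓ : ℕ) : 𝓞 K) ∈ v.asIdeal}.Finite := by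
    have hI : (Ideal.span {((ℓ : ℕ) : 𝓞 K)} : Ideal (𝓞 K)) ≠ ⊥ := by
      rw [Ne, Ideal.span_singleton_eq_bot]
      exact_mod_cast (Fact.out : ℓ.Prime).ne_zero
    refine (Ideal.finite_factors hI).subset fun v hv => ?_
    exact Ideal.dvd_iff_le.mpr ((Ideal.span_singleton_le_iff_mem _).mpr hv)
  set S' : Set (HeightOneSpectrum (𝓞 K)) := S ∪ {v | ((ℓ : ℕ) : 𝓞 K) ∈ v.asIdeal} with hS'def
  have hS' : S'.Finite := hS.union hSℓ
  have hD := absoluteGaloisGroup.frobenius_dense Automorphic.chebotarev_artinRep_holds K S' hS'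
  set D : Set (absoluteGaloisGroup K) :=
    {σ | ∃ v ∉ S', ∃ 𝔓 ∈ v.primesAbove, IsArithFrobAt (𝓞 K) σ 𝔓} with hDdef
  have hDv : ∀ σ ∈ D, ∃ v : HeightOneSpectrum (𝓞 K), v ∉ S ∧ ((ℓ : ℕ) : 𝓞 K) ∉ v.asIdeal ∧
      ∃ 𝔓 ∈ v.primesAbove, IsArithFrobAt (𝓞 K) σ 𝔓 := by
    rintro σ ⟨v, hv, 𝔓, h𝔓, hσ⟩
    exact ⟨v, fun h => hv (Or.inl h), fun h => hv (Or.inr h), 𝔓, h𝔓, hσ⟩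
  -- the coefficient functions `c m k : g ↦ coeff_k charpoly(ρ'_m g)` and their targets on `D`
  set c : ℕ → ℕ → absoluteGaloisGroup K → PadicAlgCl ℓ :=
    fun m k g => (FramedRep.charpoly (ρ' m) g).coeff k with hcdef
  have hc_cont : ∀ m k, Continuous (c m k) := fun m k => continuous_coeff_charpoly (ρ' m) k
  have hcP : ∀ m k (v : HeightOneSpectrum (𝓞 K)), v ∉ S → ((ℓ : ℕ) : 𝓞 K) ∉ v.asIdeal →
      ∀ 𝔓 ∈ v.primesAbove, ∀ σ, IsArithFrobAt (𝓞 K) σ 𝔓 → ‖c m k σ - (P v).coeff k‖ ≤ r m := by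
    intro m k v hv hℓv 𝔓 h𝔓 σ hσ
    obtain ⟨-, Q, hQ, hQP⟩ := hρ' m v hv hℓv
    have hQσ : FramedRep.charpoly (ρ' m) σ = Q := hQ 𝔓 h𝔓 σ hσ
    simp only [c, hQσ]
    exact hQP k
  let t : ℕ → absoluteGaloisGroup K → PadicAlgCl ℓ :=
    fun k σ => if hσ : σ ∈ D then (P (hDv σ hσ).choose).coeff k else 0
  have htE : ∀ k, ∀ d ∈ D, t k d ∈ E := by
    intro k d hd
    simp only [t, dif_pos hd]
    exact hP _ (hDv d hd).choose_spec.1 k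
  have happ : ∀ k m, ∀ d ∈ D, ‖c m k d - t k d‖ ≤ r m := by
    intro k m d hd
    simp only [t, dif_pos hd]
    obtain ⟨hvS, hvℓ, 𝔓, h𝔓, hσ⟩ := (hDv d hd).choose_spec
    exact hcP m k _ hvS hvℓ 𝔓 h𝔓 d hσ
  -- Step 1: uniform limits `T k` of the coefficient functions
  have hT : ∀ k, ∃ Tk : absoluteGaloisGroup K → PadicAlgCl ℓ, Continuous Tk ∧ (∀ g, Tk g ∈ E) ∧
      (∀ m g, ‖c m k g - Tk g‖ ≤ r m) ∧ ∀ d ∈ D, Tk d = t k d := fun k =>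
    exists_continuous_limit_of_dense hD E (fun m => c m k) (fun m => hc_cont m k) (t k) (htE k)
      (happ k)
  choose T hT_cont hT_E hT_bd _hT_D using hT
  have hT_lim : ∀ k g, Tendsto (fun m => c m k g) atTop (𝓝 (T k g)) := by
    intro k g
    refine tendsto_iff_norm_sub_tendsto_zero.2 ?_
    exact squeeze_zero (fun m => norm_nonneg _) (fun m => hT_bd k m g) hr_lim
  have hc_n : ∀ m g, c m n g = 1 := by
    intro m g
    have hmon := Matrix.charpoly_monic
      ((ρ' m g : GL (Fin n) (PadicAlgCl ℓ)) : Matrix (Fin n) (Fin n) (PadicAlgCl ℓ))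
    have hdeg := Matrix.charpoly_natDegree_eq_dim
      ((ρ' m g : GL (Fin n) (PadicAlgCl ℓ)) : Matrix (Fin n) (Fin n) (PadicAlgCl ℓ))
    rw [Fintype.card_fin] at hdeg
    have h := hmon.coeff_natDegree
    rw [hdeg] at h
    exact h
  have hc_gt : ∀ m g k, n < k → c m k g = 0 := by
    intro m g k hk
    apply coeff_eq_zero_of_natDegree_lt
    rw [natDegree_charpoly]
    exact hk
  have hT_n : ∀ g, T n g = 1 := fun g =>
    tendsto_nhds_unique (hT_lim n g) (by simp_rw [hc_n]; exact tendsto_const_nhds)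
  have hT_gt : ∀ g k, n < k → T k g = 0 := fun g k hk =>
    tendsto_nhds_unique (hT_lim k g) (by simp_rw [hc_gt _ g k hk]; exact tendsto_const_nhds)
  -- Step 2: the limit characteristic polynomial `χ g`
  let χ : absoluteGaloisGroup K → (PadicAlgCl ℓ)[X] :=
    fun g => X ^ n + ∑ i : Fin n, C (T i g) * X ^ (i : ℕ)
  have hχ_monic : ∀ g, (χ g).Monic := fun g =>
    monic_X_pow_add (degree_sum_fin_lt fun i : Fin n => T i g)
  have hχ_deg : ∀ g, (χ g).natDegree = n := by
    intro g
    show (X ^ n + ∑ i : Fin n, C (T i g) * X ^ (i : ℕ)).natDegree = n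
    rw [natDegree_add_eq_left_of_degree_lt, natDegree_X_pow]
    rw [degree_X_pow]
    exact degree_sum_fin_lt fun i : Fin n => T i g
  have hχ_coeff : ∀ g k, (χ g).coeff k = T k g := by
    intro g k
    rcases lt_trichotomy k n with hk | rfl | hk
    · show (X ^ n + ∑ i : Fin n, C (T i g) * X ^ (i : ℕ)).coeff k = T k g
      rw [coeff_add, coeff_X_pow, if_neg hk.ne, zero_add, finsetSum_coeff]
      simp only [coeff_C_mul_X_pow]
      rw [Fin.sum_univ_eq_sum_range (fun i => if k = i then T i g else 0) n, Finset.sum_ite_eq,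
        if_pos (Finset.mem_range.2 hk)]
    · rw [hT_n]
      have h := (hχ_monic g).coeff_natDegree
      rwa [hχ_deg] at h
    · rw [hT_gt g k hk]
      exact coeff_eq_zero_of_natDegree_lt (by rw [hχ_deg]; exact hk)
  have hχ_roots : ∀ g, Multiset.card (χ g).roots = n := fun g => by
    rw [splits_iff_card_roots.1 (IsAlgClosed.splits (χ g)), hχ_deg]
  -- Newton: power sums of roots as polynomials in the coefficients
  choose Ψ hΨ using fun j => exists_mvPolynomial_psum_eq_aeval_esymm (PadicAlgCl ℓ) n j
  let vec : (PadicAlgCl ℓ)[X] → Fin n → PadicAlgCl ℓ :=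
    fun Q i => (-1) ^ ((i : ℕ) + 1) * Q.coeff (n - ((i : ℕ) + 1))
  let Φ : ℕ → (PadicAlgCl ℓ)[X] → PadicAlgCl ℓ := fun j Q => MvPolynomial.aeval (vec Q) (Ψ j)
  have hΦ : ∀ j (Q : (PadicAlgCl ℓ)[X]), Q.Monic → Q.natDegree = n →
      Multiset.card Q.roots = n → (Q.roots.map (· ^ j)).sum = Φ j Q := by
    intro j Q hQm hQd hQr
    rw [hΨ j Q.roots hQr]
    show MvPolynomial.aeval (fun i : Fin n => Q.roots.esymm ((i : ℕ) + 1)) (Ψ j) =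
      MvPolynomial.aeval (vec Q) (Ψ j)
    suffices hfg : (fun i : Fin n => Q.roots.esymm ((i : ℕ) + 1)) = vec Q by rw [hfg]
    funext i
    have hi : (i : ℕ) + 1 ≤ n := i.2
    have h1 := Polynomial.coeff_eq_esymm_roots_of_card (p := Q) (by rw [hQr, hQd])
      (k := n - ((i : ℕ) + 1)) (by rw [hQd]; omega)
    rw [hQm.leadingCoeff, one_mul, hQd, show n - (n - ((i : ℕ) + 1)) = (i : ℕ) + 1 by omega] at h1
    show Q.roots.esymm ((i : ℕ) + 1) = (-1) ^ ((i : ℕ) + 1) * Q.coeff (n - ((i : ℕ) + 1))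
    rw [h1, ← mul_assoc, ← pow_add, ← two_mul, pow_mul, neg_one_sq, one_pow, one_mul]
  have hΦ_cont : ∀ j, Continuous fun x : Fin n → PadicAlgCl ℓ => MvPolynomial.aeval x (Ψ j) := by
    intro j
    have e : (fun x : Fin n → PadicAlgCl ℓ => MvPolynomial.aeval x (Ψ j)) =
        fun x => MvPolynomial.eval x (MvPolynomial.map (Int.castRingHom _) (Ψ j)) := by
      funext x
      rw [MvPolynomial.eval_map, MvPolynomial.aeval_def,
        Subsingleton.elim (algebraMap ℤ (PadicAlgCl ℓ)) (Int.castRingHom _)]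
    rw [e]
    exact MvPolynomial.continuous_eval _
  have hΦ_lim : ∀ j g, Tendsto (fun m => Φ j (FramedRep.charpoly (ρ' m) g)) atTop
      (𝓝 (Φ j (χ g))) := by
    intro j g
    have hvec : Tendsto (fun m => vec (FramedRep.charpoly (ρ' m) g)) atTop (𝓝 (vec (χ g))) := by
      refine tendsto_pi_nhds.2 fun i => ?_
      show Tendsto (fun m => (-1) ^ ((i : ℕ) + 1) * c m (n - ((i : ℕ) + 1)) g) atTop
        (𝓝 ((-1) ^ ((i : ℕ) + 1) * (χ g).coeff (n - ((i : ℕ) + 1))))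
      rw [hχ_coeff]
      exact (hT_lim _ g).const_mul _
    exact ((hΦ_cont j).tendsto _).comp hvec
  have hρ'Φ : ∀ m j g,
      (((ρ' m g : GL (Fin n) (PadicAlgCl ℓ)) : Matrix (Fin n) (Fin n) (PadicAlgCl ℓ)) ^ j).trace =
        Φ j (FramedRep.charpoly (ρ' m) g) := by
    intro m j g
    rw [matrix_trace_pow_eq_sum_roots_pow]
    exact hΦ j _ (Matrix.charpoly_monic _) (natDegree_charpoly (ρ' m) g)
      (card_roots_charpoly (ρ' m) g)
  -- the limit of the traces: a continuous `E`-valued pseudocharacter of dimension `n`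
  let Tr : absoluteGaloisGroup K → PadicAlgCl ℓ := fun g => Φ 1 (χ g)
  have htrΦ : ∀ m g, FramedRep.trace (ρ' m) g = Φ 1 (FramedRep.charpoly (ρ' m) g) := fun m g => by
    rw [← hρ'Φ m 1 g, pow_one]; rfl
  have hTr_lim : Tendsto (fun m => FramedRep.trace (ρ' m)) atTop (𝓝 Tr) := by
    refine tendsto_pi_nhds.2 fun g => ?_
    simp_rw [htrΦ]
    exact hΦ_lim 1 g
  have hTr_ps : IsPseudocharacter Tr n :=
    IsPseudocharacter.of_tendsto (l := atTop)
      (Eventually.of_forall fun m => Rouquier1996_prop_3_1_trace_holds (absoluteGaloisGroup K)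
        (PadicAlgCl ℓ) n ((ρ' m).toMonoidHom)) hTr_lim
  have hTr_cont : Continuous Tr := by
    have hvec : Continuous fun g => vec (χ g) := by
      refine continuous_pi fun i => ?_
      show Continuous fun g => (-1) ^ ((i : ℕ) + 1) * (χ g).coeff (n - ((i : ℕ) + 1))
      simp_rw [hχ_coeff]
      exact continuous_const.mul (hT_cont _)
    exact (hΦ_cont 1).comp hvec
  have hTr_E : ∀ g, Tr g ∈ E := by
    intro g
    have hv : ∀ i, vec (χ g) i ∈ E := fun i => by
      show (-1) ^ ((i : ℕ) + 1) * (χ g).coeff (n - ((i : ℕ) + 1)) ∈ E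
      rw [hχ_coeff]
      exact mul_mem (pow_mem (neg_mem (one_mem _)) _) (hT_E _ g)
    have hall : ∀ p : MvPolynomial (Fin n) ℤ, MvPolynomial.aeval (vec (χ g)) p ∈ E := by
      intro p
      induction p using MvPolynomial.induction_on with
      | C a =>
        rw [MvPolynomial.aeval_C, eq_intCast]
        exact intCast_mem E a
      | add p q hp hq => rw [map_add]; exact add_mem hp hq
      | mul_X p i hp => rw [map_mul, MvPolynomial.aeval_X]; exact mul_mem hp (hv i)
    exact hall (Ψ 1)
  -- Step 3: Taylor's theorem (continuous form of Bellaïche–Chenevier)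
  let Tc : ContinuousPseudocharacter (absoluteGaloisGroup K) (PadicAlgCl ℓ) n := ⟨Tr, hTr_ps, hTr_cont⟩
  obtain ⟨ρ, hss, htr, -⟩ :=
    BellaicheChenevier2009_continuous_rep_of_pseudocharacter_holds (absoluteGaloisGroup K) ℓ n E
      ‹FiniteDimensional ℚ_[ℓ] E› Tc (fun g => hTr_E g)
  -- Step 4: the characteristic polynomials of `ρ` are the limits `χ`
  have hcharpoly : ∀ g, FramedRep.charpoly ρ g = χ g := by
    intro g
    set A : Matrix (Fin n) (Fin n) (PadicAlgCl ℓ) :=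
      ((ρ g : GL (Fin n) (PadicAlgCl ℓ)) : Matrix (Fin n) (Fin n) (PadicAlgCl ℓ)) with hAdef
    have hAm : A.charpoly.Monic := Matrix.charpoly_monic _
    have hAd : A.charpoly.natDegree = n := by
      rw [Matrix.charpoly_natDegree_eq_dim, Fintype.card_fin]
    have hAr : Multiset.card A.charpoly.roots = n := by
      rw [splits_iff_card_roots.1 (IsAlgClosed.splits _), hAd]
    have hroots : A.charpoly.roots = (χ g).roots := by
      refine multiset_eq_of_psum_eq hAr (hχ_roots g) fun j _ _ => ?_
      have h1 : (A.charpoly.roots.map (· ^ j)).sum = FramedRep.trace ρ (g ^ j) := by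
        rw [← matrix_trace_pow_eq_sum_roots_pow, FramedRep.trace, map_pow, Units.val_pow_eq_pow_val]
      have h3 : Tendsto (fun m => FramedRep.trace (ρ' m) (g ^ j)) atTop (𝓝 (Tr (g ^ j))) :=
        (tendsto_pi_nhds.1 hTr_lim) (g ^ j)
      have h4 : ∀ m, FramedRep.trace (ρ' m) (g ^ j) = Φ j (FramedRep.charpoly (ρ' m) g) := fun m => by
        rw [← hρ'Φ m j g, FramedRep.trace, map_pow, Units.val_pow_eq_pow_val]
      simp_rw [h4] at h3
      have h5 : Tr (g ^ j) = Φ j (χ g) := tendsto_nhds_unique h3 (hΦ_lim j g)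
      rw [h1, htr (g ^ j), show (Tc : absoluteGaloisGroup K → PadicAlgCl ℓ) (g ^ j) = Tr (g ^ j) from rfl,
        h5]
      exact (hΦ j (χ g) (hχ_monic g) (hχ_deg g) (hχ_roots g)).symm
    calc FramedRep.charpoly ρ g = A.charpoly := rfl
      _ = (A.charpoly.roots.map fun a => X - C a).prod :=
          (prod_multiset_X_sub_C_of_monic_of_roots_card_eq hAm (by rw [hAr, hAd])).symm
      _ = ((χ g).roots.map fun a => X - C a).prod := by rw [hroots]
      _ = χ g := prod_multiset_X_sub_C_of_monic_of_roots_card_eq (hχ_monic g)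
          (by rw [hχ_roots, hχ_deg])
  -- Step 5: unramifiedness and Frobenius
  refine ⟨ρ, hss, fun v hv hℓv => ⟨?_, ?_⟩⟩
  · intro 𝔓 h𝔓 τ hτ
    have hinv : ∀ g, χ (g * τ) = χ g := by
      intro g
      have hTk : ∀ k, T k (g * τ) = T k g := by
        intro k
        have hcg : ∀ m, c m k (g * τ) = c m k g := fun m => by
          simp only [c, FramedRep.charpoly, map_mul, (hρ' m v hv hℓv).1 𝔓 h𝔓 τ hτ, mul_one]
        exact tendsto_nhds_unique (hT_lim k (g * τ)) (by simp_rw [hcg]; exact hT_lim k g)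
      ext k
      rw [hχ_coeff, hχ_coeff, hTk]
    have e : ∀ h : absoluteGaloisGroup K, (FramedRep.toRepresentation ρ h).charpoly =
        FramedRep.charpoly ρ h := fun h => by
      have e1 : (FramedRep.toRepresentation ρ h :
          (Fin n → PadicAlgCl ℓ) →ₗ[PadicAlgCl ℓ] (Fin n → PadicAlgCl ℓ)) =
          Matrix.toLin' ((ρ h : GL (Fin n) (PadicAlgCl ℓ)) : Matrix (Fin n) (Fin n) (PadicAlgCl ℓ)) :=
        LinearMap.ext fun w => by simp
      rw [e1, Matrix.charpoly_toLin']
      rfl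
    have hmem : τ ∈ Automorphic.charpolyKer (FramedRep.toRepresentation ρ) := by
      rw [Automorphic.mem_charpolyKer_iff]
      intro g
      rw [e, e, hcharpoly, hcharpoly, hinv]
    have h1 := Automorphic.apply_eq_one_of_mem_charpolyKer hss hmem
    have h2 : Matrix.toLin' ((ρ τ : GL (Fin n) (PadicAlgCl ℓ)) : Matrix (Fin n) (Fin n) (PadicAlgCl ℓ)) =
        Matrix.toLin' 1 := by
      rw [Matrix.toLin'_one]
      refine LinearMap.ext fun w => ?_
      have hw := congr($h1 w)
      simpa using hw
    exact Units.ext (Matrix.toLin'.injective h2)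
  · intro 𝔓 h𝔓 σ hσ
    rw [hcharpoly]
    ext k
    rw [hχ_coeff]
    have hb : ∀ m, ‖T k σ - (P v).coeff k‖ ≤ r m := fun m => by
      have e : T k σ - (P v).coeff k = (c m k σ - (P v).coeff k) - (c m k σ - T k σ) := by ring
      rw [e]
      exact (nsub _ _).trans (max_le (hcP m k v hv hℓv 𝔓 h𝔓 σ hσ) (hT_bd k m σ))
    have h0 : ‖T k σ - (P v).coeff k‖ ≤ 0 := ge_of_tendsto' hr_lim hb
    rw [← sub_eq_zero, ← norm_le_zero_iff]
    exact h0

/-- **Closed form** of `exists_semisimple_galoisRep_of_ladicLimit`, literally the proposition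
`GaloisRepOfLadicLimit` of the support item stmt-Langlands-2632 of route
`Langlands/DegenerateLimits` ("INTERPOLATION LEMMA (pure Galois side, known mathematics)"), so
that the item closes by `exact` on this theorem.
[cite: Taylor1991, §1 Theorem 1] [cite: GoldringKoskivirta2019, §11.1] -/
theorem galoisRepOfLadicLimit :
    ∀ (F : Type) [Field F] [NumberField F] (n : ℕ) (ℓ : ℕ) [Fact ℓ.Prime]
      (E : IntermediateField ℚ_[ℓ] (PadicAlgCl ℓ)), FiniteDimensional ℚ_[ℓ] E →
      ∀ (S : Set (IsDedekindDomain.HeightOneSpectrum (NumberField.RingOfIntegers F))), S.Finite →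
      ∀ (P : IsDedekindDomain.HeightOneSpectrum (NumberField.RingOfIntegers F) →
        Polynomial (PadicAlgCl ℓ)),
      (∀ v ∉ S, ∀ k : ℕ, (P v).coeff k ∈ E) →
      (∀ m : ℕ, ∃ ρ' : FramedGaloisRep F (PadicAlgCl ℓ) n, ∀ v ∉ S,
        ((ℓ : ℕ) : NumberField.RingOfIntegers F) ∉ v.asIdeal → ρ'.IsUnramifiedAt v ∧
          ∃ Q : Polynomial (PadicAlgCl ℓ), ρ'.HasFrobCharpolyAt v Q ∧
            ∀ k : ℕ, ‖Q.coeff k - (P v).coeff k‖ ≤ (ℓ : ℝ) ^ (-(m : ℤ))) →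
      ∃ ρ : FramedGaloisRep F (PadicAlgCl ℓ) n, ρ.toGaloisRep.IsSemisimple ∧
        ∀ v ∉ S, ((ℓ : ℕ) : NumberField.RingOfIntegers F) ∉ v.asIdeal →
          ρ.IsUnramifiedAt v ∧ ρ.HasFrobCharpolyAt v (P v) :=
  fun F _ _ n _ℓ _ E hE S hS P hP happrox =>
    haveI := hE
    exists_semisimple_galoisRep_of_ladicLimit F n E S hS P hP happrox

end Main

end Literature.NumberTheory.GaloisRepresentations
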